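import Summits.CriticalPhenomena.PercolationContinuityZ3.Theorems.PercNearOneGluingNoHeavyLowerTailBlockQ9Branch
import Summits.CriticalPhenomena.PercolationContinuityZ3.Theorems.PercNearOneGluingNoHeavyLowerTailBlockQ9Certificate
import HarnessLib

/-!
# `NoHeavyLowerTail` (stmt-CriticalPhenomena-4575) — the three NON-LEAF STEPS of the dynamic-anchor exploration certificate
# for Kozma–Nitzan's (41), for an ARBITRARY glued block

Support file (lemma factory `prim-lf-1` gen 9; `--supports stmt-CriticalPhenomena-4575`).  No definitions, no named facts, no sorries.

State of the certificate (memo FROM-prim-lf-1-gen9.md §6, HOME/EC-NOTE.md §13): weights `u` (the pairs already conditioned closed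
have weight `0`), a glued block `O` (pairs inside `O` get weight `1`), an anchor `a`; target
`(41)(u, O, a) :≡ μ_{glue_O u}(a ↔ b, O ↔ A) ≤ μ_{glue_O u}(O ↔ b)`.  Leaves are `blockQ9_of_reliableBlock` (L3) and
`blockThm4_general` (T4).  This file packages the three non-leaf moves as implications between target inequalities, with NO
one-layer / no-internal-pair hypothesis on the block:

* `blockQ9_grow` — branch on a live pair `s(s₀,v)`: (41) for `(u, insert v O, a)` and (41) for `(u − s(s₀,v), O, a)` give (41) for
  `(u, O, a)` (the branching identity `BlockQ9.T_branch`).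
* `blockQ9_up` — the same pair disposed of by the up-set exchange: `μ_{split_O u}(a ↔ b) ≤ μ_{split_O u}(v ↔ b)` (block members
  separate: pairs inside `O` deleted) and (41) for `(u − s(s₀,v), O, a)` give (41) for `(u, O, a)` (`blockQ9_step` applied to
  `split_O u`, whose gluing is the gluing of `u`).
* `blockQ9_switch` — the dynamic anchor: (41) for `a'` and `μ_{glue_O u}(a ↔ b, O ↔ A) ≤ μ_{glue_O u}(a' ↔ b, O ↔ A)` give (41) for
  `a` (cf. `blockQ9_of_transfer`, which is the one-layer Theorem-4 instance).
With these, every finite dynamic-anchor certificate (EC-dyn / EC* of the memo) is a chain of tree lemmas.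
[cite: KozmaNitzan2024, Lemma 5 and Question 9 (pp. 13, 36)]
-/

namespace Summit.CriticalPhenomena.PercolationContinuityZ3.Theorems

open MeasureTheory Set ProbabilityTheory
open Literature.Probability.LatticeModels
open Literature.Probability.Percolation

noncomputable section
open Classical

namespace BlockQ9

variable {n : ℕ}

/-- **GROW step** (branch on the live pair `s(s₀, v)`, `s₀ ∈ O`, `v ∉ O`): if (41) holds for the enlarged block `insert v O`
under `u` and for the block `O` under `u` with `s(s₀,v)` deleted, then (41) holds for `O` under `u`.
[cite: KozmaNitzan2024, Question 9 (p. 36)] -/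
theorem blockQ9_grow (u : Sym2 (Fin n) → unitInterval) (O A : Finset (Fin n)) (a b s₀ v : Fin n)
    (hs₀ : s₀ ∈ O) (hv : v ∉ O)
    (hopen : (prodBernoulli (fun d : Sym2 (Fin n) => if (∀ x ∈ d, x ∈ insert v O) ∧ ¬ d.IsDiag then 1 else u d)).real
          (openConn a b ∩ ⋃ o ∈ insert v O, ⋃ x ∈ A, openConn o x) ≤
        (prodBernoulli (fun d : Sym2 (Fin n) => if (∀ x ∈ d, x ∈ insert v O) ∧ ¬ d.IsDiag then 1 else u d)).real
          (⋃ o ∈ insert v O, openConn o b))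
    (hclosed : (prodBernoulli (fun d : Sym2 (Fin n) => if (∀ x ∈ d, x ∈ O) ∧ ¬ d.IsDiag then 1 else
          (if d = s(s₀, v) then 0 else u d))).real (openConn a b ∩ ⋃ o ∈ O, ⋃ x ∈ A, openConn o x) ≤
        (prodBernoulli (fun d : Sym2 (Fin n) => if (∀ x ∈ d, x ∈ O) ∧ ¬ d.IsDiag then 1 else
          (if d = s(s₀, v) then 0 else u d))).real (⋃ o ∈ O, openConn o b)) :
    (prodBernoulli (fun d : Sym2 (Fin n) => if (∀ x ∈ d, x ∈ O) ∧ ¬ d.IsDiag then 1 else u d)).real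
        (openConn a b ∩ ⋃ o ∈ O, ⋃ x ∈ A, openConn o x) ≤
      (prodBernoulli (fun d : Sym2 (Fin n) => if (∀ x ∈ d, x ∈ O) ∧ ¬ d.IsDiag then 1 else u d)).real
        (⋃ o ∈ O, openConn o b) := by
  have hT := T_branch u O A a b s₀ v hs₀ hv
  have h0 : (0 : ℝ) ≤ (u s(s₀, v) : ℝ) := (u s(s₀, v)).2.1
  have h1 : (u s(s₀, v) : ℝ) ≤ 1 := (u s(s₀, v)).2.2
  have hop : (u s(s₀, v) : ℝ) * ((prodBernoulli (fun d : Sym2 (Fin n) =>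
        if (∀ x ∈ d, x ∈ insert v O) ∧ ¬ d.IsDiag then 1 else u d)).real
          (openConn a b ∩ ⋃ o ∈ insert v O, ⋃ x ∈ A, openConn o x) -
        (prodBernoulli (fun d : Sym2 (Fin n) => if (∀ x ∈ d, x ∈ insert v O) ∧ ¬ d.IsDiag then 1 else u d)).real
          (⋃ o ∈ insert v O, openConn o b)) ≤ 0 :=
    mul_nonpos_of_nonneg_of_nonpos h0 (sub_nonpos.2 hopen)
  have hcl : (1 - (u s(s₀, v) : ℝ)) * ((prodBernoulli (fun d : Sym2 (Fin n) => if (∀ x ∈ d, x ∈ O) ∧ ¬ d.IsDiag then 1 else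
          (if d = s(s₀, v) then 0 else u d))).real (openConn a b ∩ ⋃ o ∈ O, ⋃ x ∈ A, openConn o x) -
        (prodBernoulli (fun d : Sym2 (Fin n) => if (∀ x ∈ d, x ∈ O) ∧ ¬ d.IsDiag then 1 else
          (if d = s(s₀, v) then 0 else u d))).real (⋃ o ∈ O, openConn o b)) ≤ 0 :=
    mul_nonpos_of_nonneg_of_nonpos (sub_nonneg.2 h1) (sub_nonpos.2 hclosed)
  linarith

/-- **UP step** (the live pair `s(s₀, v)` disposed of by the up-set exchange): if `a` is at most as connected to `b` as
`v` in the SPLIT graph (pairs inside `O` deleted, members separate) and (41) holds for `O` under `u` with `s(s₀,v)`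
deleted, then (41) holds for `O` under `u`.  (`blockQ9_step` for the split weights; their gluing equals the gluing of `u`.)
[cite: KozmaNitzan2024, Lemma 5 and Question 9 (pp. 13, 36)] -/
theorem blockQ9_up (u : Sym2 (Fin n) → unitInterval) (O A : Finset (Fin n)) (a b s₀ v : Fin n)
    (hs₀ : s₀ ∈ O) (hv : v ∉ O)
    (hyp : (prodBernoulli (fun d : Sym2 (Fin n) => if (∀ x ∈ d, x ∈ O) ∧ ¬ d.IsDiag then 0 else u d)).real (openConn a b) ≤
      (prodBernoulli (fun d : Sym2 (Fin n) => if (∀ x ∈ d, x ∈ O) ∧ ¬ d.IsDiag then 0 else u d)).real (openConn v b))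
    (hclosed : (prodBernoulli (fun d : Sym2 (Fin n) => if (∀ x ∈ d, x ∈ O) ∧ ¬ d.IsDiag then 1 else
          (if d = s(s₀, v) then 0 else u d))).real (openConn a b ∩ ⋃ o ∈ O, ⋃ x ∈ A, openConn o x) ≤
        (prodBernoulli (fun d : Sym2 (Fin n) => if (∀ x ∈ d, x ∈ O) ∧ ¬ d.IsDiag then 1 else
          (if d = s(s₀, v) then 0 else u d))).real (⋃ o ∈ O, openConn o b)) :
    (prodBernoulli (fun d : Sym2 (Fin n) => if (∀ x ∈ d, x ∈ O) ∧ ¬ d.IsDiag then 1 else u d)).real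
        (openConn a b ∩ ⋃ o ∈ O, ⋃ x ∈ A, openConn o x) ≤
      (prodBernoulli (fun d : Sym2 (Fin n) => if (∀ x ∈ d, x ∈ O) ∧ ¬ d.IsDiag then 1 else u d)).real
        (⋃ o ∈ O, openConn o b) := by
  classical
  -- the split weights: pairs inside `O` deleted
  set us : Sym2 (Fin n) → unitInterval := fun d => if (∀ x ∈ d, x ∈ O) ∧ ¬ d.IsDiag then 0 else u d with hus
  have hO0 : ∀ e : Sym2 (Fin n), (∀ x ∈ e, x ∈ O) → ¬ e.IsDiag → us e = 0 := by
    intro e h1 h2; simp only [hus, if_pos (And.intro h1 h2)]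
  -- gluing the split weights = gluing `u`
  have hglue : (fun d : Sym2 (Fin n) => if (∀ x ∈ d, x ∈ O) ∧ ¬ d.IsDiag then (1 : unitInterval) else us d) =
      (fun d : Sym2 (Fin n) => if (∀ x ∈ d, x ∈ O) ∧ ¬ d.IsDiag then 1 else u d) := by
    funext d
    by_cases h : (∀ x ∈ d, x ∈ O) ∧ ¬ d.IsDiag
    · simp only [if_pos h]
    · simp only [if_neg h, hus]
  have hglue' : (fun d : Sym2 (Fin n) => if (∀ x ∈ d, x ∈ O) ∧ ¬ d.IsDiag then (1 : unitInterval) else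
        (if d = s(s₀, v) then 0 else us d)) =
      (fun d : Sym2 (Fin n) => if (∀ x ∈ d, x ∈ O) ∧ ¬ d.IsDiag then 1 else (if d = s(s₀, v) then 0 else u d)) := by
    funext d
    by_cases h : (∀ x ∈ d, x ∈ O) ∧ ¬ d.IsDiag
    · simp only [if_pos h]
    · simp only [if_neg h, hus]
  have key := blockQ9_step us O A a b v s₀ hv hs₀ hO0 hyp (by rw [hglue']; exact hclosed)
  rw [hglue] at key
  exact key

/-- **SWITCH step** (the dynamic anchor): if (41) holds for the anchor `a'` and `μ_{glue_O u}(a ↔ b, O ↔ A) ≤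
μ_{glue_O u}(a' ↔ b, O ↔ A)`, then (41) holds for `a`.  (No hypothesis on the block; `blockQ9_of_transfer` is the
one-layer Theorem-4 instance.) [cite: KozmaNitzan2024, Question 9 (p. 36)] -/
theorem blockQ9_switch (u : Sym2 (Fin n) → unitInterval) (O A : Finset (Fin n)) (a a' b : Fin n)
    (htr : (prodBernoulli (fun d : Sym2 (Fin n) => if (∀ x ∈ d, x ∈ O) ∧ ¬ d.IsDiag then 1 else u d)).real
          (openConn a b ∩ ⋃ o ∈ O, ⋃ x ∈ A, openConn o x) ≤
        (prodBernoulli (fun d : Sym2 (Fin n) => if (∀ x ∈ d, x ∈ O) ∧ ¬ d.IsDiag then 1 else u d)).real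
          (openConn a' b ∩ ⋃ o ∈ O, ⋃ x ∈ A, openConn o x))
    (h41 : (prodBernoulli (fun d : Sym2 (Fin n) => if (∀ x ∈ d, x ∈ O) ∧ ¬ d.IsDiag then 1 else u d)).real
          (openConn a' b ∩ ⋃ o ∈ O, ⋃ x ∈ A, openConn o x) ≤
        (prodBernoulli (fun d : Sym2 (Fin n) => if (∀ x ∈ d, x ∈ O) ∧ ¬ d.IsDiag then 1 else u d)).real
          (⋃ o ∈ O, openConn o b)) :
    (prodBernoulli (fun d : Sym2 (Fin n) => if (∀ x ∈ d, x ∈ O) ∧ ¬ d.IsDiag then 1 else u d)).real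
        (openConn a b ∩ ⋃ o ∈ O, ⋃ x ∈ A, openConn o x) ≤
      (prodBernoulli (fun d : Sym2 (Fin n) => if (∀ x ∈ d, x ∈ O) ∧ ¬ d.IsDiag then 1 else u d)).real
        (⋃ o ∈ O, openConn o b) :=
  htr.trans h41

/-- **Root form**: for a single observer vertex `o` the gluing is trivial, so (41) for the block `{o}` is Kozma–Nitzan's (41)
at `o`:  `μ_u(a ↔ b, o ↔ A) ≤ μ_u(o ↔ b)`. [cite: KozmaNitzan2024, (41) p. 36] -/
theorem q9_of_block_singleton (u : Sym2 (Fin n) → unitInterval) (A : Finset (Fin n)) (o a b : Fin n)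
    (h : (prodBernoulli (fun d : Sym2 (Fin n) => if (∀ x ∈ d, x ∈ ({o} : Finset (Fin n))) ∧ ¬ d.IsDiag then 1 else u d)).real
          (openConn a b ∩ ⋃ o' ∈ ({o} : Finset (Fin n)), ⋃ x ∈ A, openConn o' x) ≤
        (prodBernoulli (fun d : Sym2 (Fin n) => if (∀ x ∈ d, x ∈ ({o} : Finset (Fin n))) ∧ ¬ d.IsDiag then 1 else u d)).real
          (⋃ o' ∈ ({o} : Finset (Fin n)), openConn o' b)) :
    (prodBernoulli u).real (openConn a b ∩ ⋃ x ∈ A, openConn o x) ≤ (prodBernoulli u).real (openConn o b) := by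
  rw [goodStep24_glue_singleton] at h
  simpa only [Finset.mem_singleton, iUnion_iUnion_eq_left] using h

end BlockQ9

end

end Summit.CriticalPhenomena.PercolationContinuityZ3.Theorems
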